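import Mathlib
import Summits.MatrixMultiplication.MatrixMultiplication.Theses.FourierTwoFamiliesModP
import Literature.Computability.AlgebraicComplexity.SimultaneousDoubleProduct

/-!
# Sketch — first lemmas of the crux-idea cards for `PrimeCyclicPowerGain`
(stmt-MatrixMultiplication-14309; planner-cruxidea …-14309-2, round 1)

Card `clique-coclique-direct-sum-clique`: `TranslateClassWall`, `CoreClassWall`.
Card `fekete-submultiplicativity-integer-lift`: `IntegerLift`, `RadixStacking`, `ScaleSubmult`,
`FeketeReduction`.
All are `Prop`s (statements only); nothing is asserted.
-/

namespace Summit.MatrixMultiplication.MatrixMultiplication.Cruxes.PrimeCyclicPowerGain.Sketch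

open Finset
open scoped Pointwise
open Literature.Computability.AlgebraicComplexity (IsSDPP)
open Summit.MatrixMultiplication.MatrixMultiplication.Theses.FourierTwoFamiliesModP
  (PrimeCyclicPowerGain PrimeDensityDecay)

/-- Card 1, first lemma (provable now; clique–coclique double count):
a TRANSLATE family `A i = A₀ + tᵢ`, `B i = B₀ + tᵢ` with the SDPP obeys the wall `n·s² ≤ p`
(the sets `tᵢ + (A₀ + B₀)` are pairwise disjoint of size `s²`). -/
def TranslateClassWall : Prop :=
  ∀ p : ℕ, p.Prime → ∀ (n s : ℕ) (A₀ B₀ : Finset (ZMod p)) (t : Fin n → ZMod p),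
    A₀.card = s → B₀.card = s →
    IsSDPP (fun i => A₀.image (· + t i)) (fun i => B₀.image (· + t i)) →
    n * s ^ 2 ≤ p

/-- Card 1, operative form (provable now from `TranslateClassWall` + `IsSDPP.mono` +
`IsSDPP.reindex`): if a translated CORE `(Ac + t r, Bc + t r)` sits inside `m` distinct blocks
of an arbitrary SDPP family in `ℤ/p`, then `m · |Ac| · |Bc| ≤ p`. -/
def CoreClassWall : Prop :=
  ∀ p : ℕ, p.Prime → ∀ (n m : ℕ) (A B : Fin n → Finset (ZMod p)) (ι : Fin m → Fin n)
    (Ac Bc : Finset (ZMod p)) (t : Fin m → ZMod p),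
    Function.Injective ι → IsSDPP A B →
    (∀ r : Fin m, Ac.image (· + t r) ⊆ A (ι r)) →
    (∀ r : Fin m, Bc.image (· + t r) ⊆ B (ι r)) →
    m * (Ac.card * Bc.card) ≤ p

/-- Card 2, first lemma (a) (provable now): the SDPP lifts for free from `ℤ/p` to `ℤ`
(representatives in `[0,p)`): a solution of `(a-a')+(b-b') = 0` in `ℤ` is one mod `p`. -/
def IntegerLift : Prop :=
  ∀ p : ℕ, p.Prime → ∀ (n : ℕ) (A B : Fin n → Finset (ZMod p)), IsSDPP A B →
    IsSDPP (fun i => (A i).image (fun x : ZMod p => (x.val : ℤ)))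
           (fun i => (B i).image (fun x : ZMod p => (x.val : ℤ)))

/-- Card 2, first lemma (b) (provable now; exact super-multiplicativity by radix stacking):
an integer SDPP family with blocks inside `[0,N)` and a second integer SDPP family stack, with
radix `2N`, into an SDPP family with `n·n'` blocks `A i + 2N·A' i'`, `B i + 2N·B' i'`
(the low part of `(a-a')+(b-b')` lies in `(-2N, 2N)`, so both levels vanish separately). -/
def RadixStacking : Prop :=
  ∀ (N n n' : ℕ) (A B : Fin n → Finset ℤ) (A' B' : Fin n' → Finset ℤ),
    IsSDPP A B → IsSDPP A' B' →
    (∀ i, ∀ x ∈ A i, 0 ≤ x ∧ x < N) → (∀ i, ∀ x ∈ B i, 0 ≤ x ∧ x < N) →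
    IsSDPP
      (fun q : Fin (n * n') =>
        A (finProdFinEquiv.symm q).1 + (A' (finProdFinEquiv.symm q).2).image (fun x => 2 * (N : ℤ) * x))
      (fun q : Fin (n * n') =>
        B (finProdFinEquiv.symm q).1 + (B' (finProdFinEquiv.symm q).2).image (fun x => 2 * (N : ℤ) * x))

/-- Card 2, THE BET (approximate sub-multiplicativity across scales with an absolute constant
`C`): a balanced SDPP family with block size `s₁·s₂` in a prime cyclic group is at most `C` times
as dense as the product of the densities of two balanced SDPP families with block sizes `s₁` and
`s₂` in prime cyclic groups. -/
def ScaleSubmult (C : ℝ) : Prop :=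
  ∀ p : ℕ, p.Prime → ∀ (n s₁ s₂ : ℕ) (A B : Fin n → Finset (ZMod p)), 2 ≤ s₁ → 2 ≤ s₂ →
    (∀ i, (A i).card = s₁ * s₂ ∧ (B i).card = s₁ * s₂) → IsSDPP A B →
    ∃ (p₁ n₁ : ℕ) (A₁ B₁ : Fin n₁ → Finset (ZMod p₁)) (p₂ n₂ : ℕ)
      (A₂ B₂ : Fin n₂ → Finset (ZMod p₂)),
      p₁.Prime ∧ p₂.Prime ∧
      (∀ i, (A₁ i).card = s₁ ∧ (B₁ i).card = s₁) ∧ (∀ i, (A₂ i).card = s₂ ∧ (B₂ i).card = s₂) ∧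
      IsSDPP A₁ B₁ ∧ IsSDPP A₂ B₂ ∧
      ((n : ℝ) * ((s₁ * s₂ : ℕ) : ℝ) / (p : ℝ)
        ≤ C * ((n₁ : ℝ) * (s₁ : ℝ) / (p₁ : ℝ)) * ((n₂ : ℝ) * (s₂ : ℝ) / (p₂ : ℝ)))

/-- Card 2, the transfer (provable now, Fekete-type bookkeeping + `IsSDPP.mono`):
sub-multiplicativity with ANY absolute constant plus the route's qualitative rung
`PrimeDensityDecay` (rank 4) give the crux `PrimeCyclicPowerGain` (rank 2), with
`c = (log 2) / (2 log s*)` for `s* = s₀(1/(2C))`. -/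
def FeketeReduction : Prop :=
  ∀ C : ℝ, 0 < C → ScaleSubmult C → PrimeDensityDecay → PrimeCyclicPowerGain

end Summit.MatrixMultiplication.MatrixMultiplication.Cruxes.PrimeCyclicPowerGain.Sketch
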